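import Literature.Algebra.Homology.GroupCohomologyCupProductCommutative
import HarnessLib

/-!
# The cup product `Hᵖ(G, M) × H^q(G, N) → H^{p+q}(G, M ⊗ N)` with coefficients (Brown V §3)

Topic `Algebra/Homology`; namespace `Literature.Algebra.Homology`.  Definitions with bodies and
theorems; NO named fact, no `sorry`.  Sequel of `GroupCohomologyCupProduct` (trivial coefficients)
and `GroupCohomologyCupProductCommutative` (the calculus `nerveMap` of restrictions of inhomogeneous
words along arbitrary vertex maps): the general cup product of K. S. Brown, *Cohomology of Groups*,
V §3 [book:brown1982-cohomology-groups p0115 L24 – p0116 L1], on Mathlib's `groupCohomology M p` for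
ARBITRARY representations `M N : Rep k G` of an arbitrary group `G` over a commutative ring `k`, with
values in the tensor product representation `M ⊗ N` (Mathlib's monoidal structure on `Rep k G`,
diagonal action): Brown's Alexander–Whitney formula

  "`(u ∪ v)(g₁, …, g_{p+q}) = (−1)^{pq} u(g₁, …, g_p) ⊗ g₁⋯g_p · v(g_{p+1}, …, g_{p+q})`".

As in the trivial-coefficient file, Brown's global sign `(−1)^{pq}` (an artefact of his sign
convention for `Hom` complexes, p0115 L1) is dropped: with Mathlib's (Eilenberg–MacLane) coboundary
`(δf)(g₀, …, gₙ) = g₀ f(g₁, …, gₙ) + Σⱼ (−1)^{j+1} f(…, gⱼgⱼ₊₁, …) + (−1)^{n+1} f(g₀, …, gₙ₋₁)` the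
sign-free product

  `(f ∪ g)(x₁, …, x_{p+q}) = f(x₁, …, x_p) ⊗ (x₁⋯x_p) · g(x_{p+1}, …, x_{p+q})`     (`cupCochainRep`)

satisfies the Leibniz rule `δ(f ∪ g) = δf ∪ g + (−1)ᵖ f ∪ δg` ON THE NOSE (`d_cupCochainRep`), which
is all that is used (this is also the formula of Cartan–Eilenberg / Neukirch–Schmidt–Wingberg I §4).

## The proof of the Leibniz rule (simplicially)

In the bar notation `[x₁|⋯|xₙ] = (1, x₁, x₁x₂, …)` (Brown I §5) an `M`-valued inhomogeneous cochain `u`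
is the `G`-equivariant homogeneous cochain `U(g₀, …, gₙ) = g₀ · u(g₀⁻¹g₁, …, gₙ₋₁⁻¹gₙ)`; restricting
`U` along an ARBITRARY vertex map `f : Fin (m+1) → Fin (n+1)` reads, in inhomogeneous coordinates,

  `(f^*u)(x) = (∏_{<f 0} x) · u(nerveMap f x)`                                   (`nervePull`)

(the transport of the base vertex `f 0` is the twist).  This is functorial
(`nervePull_nervePull`), Mathlib's coboundary is `δu = Σₐ (−1)ᵃ δₐ^*u` over the cofaces
`δₐ = Fin.succAbove a` — the term `a = 0` carrying exactly the twist `x₀ ·` of the first summand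
(`d_eq_sum_nervePull`) — and the cup product is `(f ∪ g)(x) = (front^*f)(x) ⊗ (back^*g)(x)`
(`cupCochainRep_apply_eq`), the twist `x₁⋯x_p` being the transport of the first vertex `p` of the back
face.  The Leibniz rule is then the standard splitting of the cofaces `δₐ`, `a ≤ p + q + 1`, into
`a ≤ p` (`δₐ ∘ front_p = front_{p+1} ∘ δₐ`, `δₐ ∘ back_q = back_q`) and `a = p + 1 + b`
(`δₐ ∘ front_p = front_p`, `δₐ ∘ back_q = back_{q+1} ∘ δ_{b+1}`), the last coface of `δf ∪ g` cancelling
the first coface of `f ∪ δg` [Brown V §3, proof of (3.3): "the formula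
`δ(a ∪ b) = δa ∪ b + (−1)^{deg a} a ∪ δb`"].

## Contents

* §1 `nervePull M f` and its calculus (`nervePull_nervePull`, `nervePull_id`, `nervePull_tmul`,
  **`d_eq_sum_nervePull`**).
* §2 **`cupCochainRep M N h`** (`k`-bilinear), `cupCochainRep_apply_eq` (front/back pull-backs),
  **`d_cupCochainRep`** (Leibniz), `cupCochainRep_d_left/right`.
* §3 `cocyclesCupRep`, **`cupProductRep M N h : Hᵖ(G, M) →ₗ[k] H^q(G, N) →ₗ[k] Hᵐ(G, M ⊗ N)`**,
  `[f] ∪ [g] = [f ∪ g]` (`cupProductRep_π_π`).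
* §4 Brown (3.2), naturality in the coefficients: **`map_tensorHom_cupProductRep`**
  `(φ ⊗ ψ)_*(u ∪ v) = φ_*u ∪ ψ_*v`.
* §5 junction with the trivial-coefficient product `cupProduct` of `GroupCohomologyCupProduct`:
  `lid_cupCochainRep_trivial`, **`map_leftUnitor_cupProductRep_trivial`** (the multiplication
  `k ⊗ k → k` = the unitor `λ_k` carries `cupProductRep k k` to `cupProduct`).
* §6 Brown (3.4) with coefficients: `map_leftUnitor_cupUnit_cupProductRep` (`λ_*(1 ∪ v) = v`),
  `map_rightUnitor_cupProductRep_cupUnit` (`ρ_*(u ∪ 1) = u`).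
* §7 Brown (3.5) with coefficients: `associator_cupCochainRep` (on cochains),
  **`map_associator_cupProductRep`** (`α_*((u ∪ v) ∪ w) = u ∪ (v ∪ w)`).

Not here: (3.1) (degree `0` bookkeeping), (3.3) (connecting homomorphisms), (3.6) with the twist
`t : N ⊗ M → M ⊗ N` (sequel file), (3.7) with coefficients.
-- TODO(general form): (3.3), (3.7) of Brown V §3 with coefficients.

## References

* K. S. Brown, *Cohomology of Groups*, GTM 87, Springer (1982), V §3 (the cup product with
  coefficients `M ⊗ N`, Alexander–Whitney formula p. 110, (3.2), proof of (3.3), (3.4), (3.5));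
  I §5 (bar notation).
  [Brown1982CohomologyGroups] — held copy `book:brown1982-cohomology-groups`, chunks p0115–p0117, p0027.
* J. Neukirch, A. Schmidt, K. Wingberg, *Cohomology of Number Fields*, 2nd ed. (2008), I §4
  (cup product of inhomogeneous cochains with coefficients). [NeukirchSchmidtWingberg2008]
-/

noncomputable section

open CategoryTheory MonoidalCategory groupCohomology
open scoped TensorProduct

universe u

namespace Literature.Algebra.Homology

variable {k G : Type u} [CommRing k] [Group G]

/-! ### §1 Pull-back of cochains with coefficients along vertex maps -/

section Pull

variable (M N : Rep.{u} k G) {n m l p q : ℕ}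

/-- **Pull-back of an `M`-valued inhomogeneous cochain along a vertex map** `f : Fin (m+1) → Fin (n+1)`:
`(f^*u)(x) = (∏_{<f 0} x) · u(nerveMap f x)` — the restriction of the `G`-equivariant homogeneous
cochain `(g₀, …, gₘ) ↦ g₀ · u(g₀⁻¹g₁, …)` of the bar resolution along `(g₀, …, gₙ) ↦ (g_{f 0}, …, g_{f m})`,
written in the bar notation `[x₁|⋯|xₙ] = (1, x₁, x₁x₂, …)`; `k`-linear in `u`.
[cite: Brown1982CohomologyGroups, I §5 (bar notation) and III §1 (p. 59)] -/
def nervePull (f : Fin (m + 1) → Fin (n + 1)) : ((Fin m → G) → M) →ₗ[k] ((Fin n → G) → M) where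
  toFun u x := M.ρ (Fin.partialProd x (f 0)) (u (nerveMap f x))
  map_add' u v := funext fun x => by simp only [Pi.add_apply, map_add]
  map_smul' r u := funext fun x => by simp only [Pi.smul_apply, map_smul, RingHom.id_apply]

/-- `(f^*u)(x) = (∏_{<f 0} x) · u(nerveMap f x)`. [cite: Brown1982CohomologyGroups, I §5 (bar notation)] -/
@[simp]
theorem nervePull_apply (f : Fin (m + 1) → Fin (n + 1)) (u : (Fin m → G) → M) (x : Fin n → G) :
    nervePull M f u x = M.ρ (Fin.partialProd x (f 0)) (u (nerveMap f x)) :=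
  rfl

/-- **Functoriality**: `f'^*(f^*u) = (f' ∘ f)^*u` (the twists compose by `partialProd_nerveMap`).
[cite: Brown1982CohomologyGroups, I §5 Exercise 3 (a)] -/
theorem nervePull_nervePull (f : Fin (m + 1) → Fin (n + 1)) (f' : Fin (n + 1) → Fin (l + 1))
    (u : (Fin m → G) → M) : nervePull M f' (nervePull M f u) = nervePull M (f' ∘ f) u := by
  funext x
  rw [nervePull_apply, nervePull_apply, nervePull_apply, nerveMap_nerveMap, partialProd_nerveMap,
    ← Module.End.mul_apply, ← map_mul, mul_inv_cancel_left]
  rfl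

/-- `id^* u = u`. [cite: Brown1982CohomologyGroups, I §5 (bar notation)] -/
@[simp]
theorem nervePull_id (u : (Fin n → G) → M) : nervePull M id u = u := by
  funext x
  rw [nervePull_apply, nerveMap_id, id, Fin.partialProd_zero, map_one, Module.End.one_apply]

/-- Pull-back of a tensor-valued cochain `y ↦ A(y) ⊗ B(y)` is the tensor of the pull-backs (the
action on `M ⊗ N` is diagonal). [cite: Brown1982CohomologyGroups, V §3 (diagonal action on M ⊗ N)] -/
theorem nervePull_tmul (f : Fin (m + 1) → Fin (n + 1)) (A : (Fin m → G) → M) (B : (Fin m → G) → N)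
    (x : Fin n → G) :
    nervePull (M ⊗ N) f (fun y => (A y ⊗ₜ[k] B y : M.V ⊗[k] N.V)) x =
      (nervePull M f A x ⊗ₜ[k] nervePull N f B x : M.V ⊗[k] N.V) := by
  rw [nervePull_apply, nervePull_apply, nervePull_apply, Rep.tensor_ρ, Representation.tprod_apply,
    TensorProduct.map_tmul]

/-- **Mathlib's coboundary as the alternating sum of coface pull-backs**:
`δu = Σ_{a ≤ n+1} (−1)ᵃ δₐ^*u` in `Cⁿ⁺¹(G, M)`, the coface `δ₀` carrying the twist `x₀ · u(x₁, …, xₙ)`.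
[cite: Brown1982CohomologyGroups, I §5 (5.2) and III §1 Example 3] -/
theorem d_eq_sum_nervePull (u : (Fin n → G) → M) :
    inhomogeneousCochains.d M n u =
      ∑ a : Fin (n + 2), (-1 : k) ^ (a : ℕ) • nervePull M (Fin.succAbove a) u := by
  funext x
  rw [Finset.sum_apply, Fin.sum_univ_succ, inhomogeneousCochains.d_hom_apply]
  congr 1
  · rw [Fin.val_zero, pow_zero, one_smul, nervePull_apply, nerveMap_succAbove_zero, Fin.succAbove_zero,
      Fin.partialProd_succ, Fin.castSucc_zero, Fin.partialProd_zero, one_mul]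
  · refine Finset.sum_congr rfl fun j _ => ?_
    rw [Pi.smul_apply, Fin.val_succ, nervePull_apply, nerveMap_succAbove_succ,
      Fin.succAbove_ne_zero_zero (Fin.succ_ne_zero j), Fin.partialProd_zero, map_one, Module.End.one_apply]

/-- The same evaluated at a word. [cite: Brown1982CohomologyGroups, I §5 (5.2)] -/
theorem d_apply_eq_sum_nervePull (u : (Fin n → G) → M) (x : Fin (n + 1) → G) :
    inhomogeneousCochains.d M n u x =
      ∑ a : Fin (n + 2), (-1 : k) ^ (a : ℕ) • nervePull M (Fin.succAbove a) u x := by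
  rw [d_eq_sum_nervePull, Finset.sum_apply]
  rfl

end Pull

/-! ### §2 The cup product of cochains with coefficients and its Leibniz rule -/

section Cochains

variable (M N : Rep.{u} k G) {n m p q : ℕ}

/-- **Brown's cup product of inhomogeneous cochains with coefficients** (Alexander–Whitney formula,
sign-free form): for `f ∈ Cᵖ(G, M)`, `g ∈ C^q(G, N)`, `p + q = m`,
`(f ∪ g)(x₁, …, x_m) = f(x₁, …, x_p) ⊗ (x₁⋯x_p) · g(x_{p+1}, …, x_m) ∈ M ⊗ N`; `k`-bilinear.
[cite: Brown1982CohomologyGroups, V §3 (Alexander–Whitney formula)] -/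
def cupCochainRep (h : p + q = m) :
    ((Fin p → G) → M) →ₗ[k] ((Fin q → G) → N) →ₗ[k] ((Fin m → G) → (M ⊗ N : Rep k G)) :=
  LinearMap.mk₂ k
    (fun f g x => (f (frontWord h x) ⊗ₜ[k]
      N.ρ (Fin.partialProd x ⟨p, by omega⟩) (g (backWord h x)) : M.V ⊗[k] N.V))
    (fun f f' g => funext fun x => by simp only [Pi.add_apply, TensorProduct.add_tmul])
    (fun c f g => funext fun x => by simp only [Pi.smul_apply, TensorProduct.smul_tmul'])
    (fun f g g' => funext fun x => by simp only [Pi.add_apply, map_add, TensorProduct.tmul_add])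
    (fun c f g => funext fun x => by simp only [Pi.smul_apply, map_smul, TensorProduct.tmul_smul])

/-- `(f ∪ g)(x) = f(x₁, …, x_p) ⊗ (x₁⋯x_p) · g(x_{p+1}, …, x_m)`.
[cite: Brown1982CohomologyGroups, V §3 (Alexander–Whitney formula)] -/
@[simp]
theorem cupCochainRep_apply (h : p + q = m) (f : (Fin p → G) → M) (g : (Fin q → G) → N)
    (x : Fin m → G) :
    cupCochainRep M N h f g x =
      (f (frontWord h x) ⊗ₜ[k] N.ρ (Fin.partialProd x ⟨p, by omega⟩) (g (backWord h x)) :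
        M.V ⊗[k] N.V) :=
  rfl

/-- **The cup product through vertex maps**: `(f ∪ g)(x) = (front_p^* f)(x) ⊗ (back_q^* g)(x)` — the
twist `x₁⋯x_p` is the transport of the first vertex `p` of the back face.
[cite: Brown1982CohomologyGroups, V §3 (Alexander–Whitney formula)] -/
theorem cupCochainRep_apply_eq (h : p + q = m) (f : (Fin p → G) → M) (g : (Fin q → G) → N)
    (x : Fin m → G) :
    cupCochainRep M N h f g x =
      (nervePull M (nerveFrontMap p m (by omega)) f x ⊗ₜ[k] nervePull N (nerveBackMap q m (by omega)) g x :
        M.V ⊗[k] N.V) := by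
  rw [cupCochainRep_apply, nervePull_apply, nervePull_apply, ← frontWord_eq_nerveMap h,
    ← backWord_eq_nerveMap h]
  have h0 : nerveFrontMap p m (by omega) 0 = 0 := rfl
  have hp : nerveBackMap q m (by omega) 0 = ⟨p, by omega⟩ :=
    Fin.ext (by simp only [nerveBackMap, Fin.val_zero]; omega)
  rw [h0, Fin.partialProd_zero, map_one, Module.End.one_apply, hp]

/-- The cup product as the function `x ↦ (front^* f)(x) ⊗ (back^* g)(x)`.
[cite: Brown1982CohomologyGroups, V §3 (Alexander–Whitney formula)] -/
theorem cupCochainRep_eq (h : p + q = m) (f : (Fin p → G) → M) (g : (Fin q → G) → N) :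
    cupCochainRep M N h f g = fun x =>
      (nervePull M (nerveFrontMap p m (by omega)) f x ⊗ₜ[k] nervePull N (nerveBackMap q m (by omega)) g x :
        M.V ⊗[k] N.V) :=
  funext (cupCochainRep_apply_eq M N h f g)

open Literature.AlgebraicTopology.SingularHomology.TwistedPrism (val_succAbove) in
/-- Cofaces `a ≤ p` commute past the front face: `δₐ ∘ front_p = front_{p+1} ∘ δₐ`. [folklore] -/
private theorem succAbove_comp_nerveFrontMap_of_le (h : p + q = m) (a : Fin (m + 2)) (i : Fin (p + 1))
    (ha : (a : ℕ) = i) :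
    Fin.succAbove a ∘ nerveFrontMap p m (by omega) =
      nerveFrontMap (p + 1) (m + 1) (by omega) ∘ Fin.succAbove (Fin.castSucc i) := by
  funext t
  apply Fin.ext
  simp only [Function.comp_apply, nerveFrontMap, val_succAbove, Fin.val_castSucc]
  split_ifs <;> omega

open Literature.AlgebraicTopology.SingularHomology.TwistedPrism (val_succAbove) in
/-- Cofaces `a ≤ p` do not move the back face: `δₐ ∘ back_q = back_q`. [folklore] -/
private theorem succAbove_comp_nerveBackMap_of_le (h : p + q = m) (a : Fin (m + 2)) (i : Fin (p + 1))
    (ha : (a : ℕ) = i) :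
    Fin.succAbove a ∘ nerveBackMap q m (by omega) = nerveBackMap q (m + 1) (by omega) := by
  funext t
  apply Fin.ext
  simp only [Function.comp_apply, nerveBackMap, val_succAbove]
  split_ifs <;> omega

open Literature.AlgebraicTopology.SingularHomology.TwistedPrism (val_succAbove) in
/-- Cofaces `a = p + 1 + b` do not move the front face: `δₐ ∘ front_p = front_p`. [folklore] -/
private theorem succAbove_comp_nerveFrontMap_of_gt (h : p + q = m) (a : Fin (m + 2)) (j : Fin (q + 1))
    (ha : (a : ℕ) = p + 1 + j) :
    Fin.succAbove a ∘ nerveFrontMap p m (by omega) = nerveFrontMap p (m + 1) (by omega) := by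
  funext t
  apply Fin.ext
  simp only [Function.comp_apply, nerveFrontMap, val_succAbove]
  split_ifs <;> omega

open Literature.AlgebraicTopology.SingularHomology.TwistedPrism (val_succAbove) in
/-- Cofaces `a = p + 1 + b` act on the back face: `δₐ ∘ back_q = back_{q+1} ∘ δ_{b+1}`. [folklore] -/
private theorem succAbove_comp_nerveBackMap_of_gt (h : p + q = m) (a : Fin (m + 2)) (j : Fin (q + 1))
    (ha : (a : ℕ) = p + 1 + j) :
    Fin.succAbove a ∘ nerveBackMap q m (by omega) =
      nerveBackMap (q + 1) (m + 1) (by omega) ∘ Fin.succAbove j.succ := by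
  funext t
  apply Fin.ext
  simp only [Function.comp_apply, nerveBackMap, val_succAbove, Fin.val_succ]
  split_ifs <;> omega

open Literature.AlgebraicTopology.SingularHomology.TwistedPrism (val_succAbove) in
/-- The last coface of the front: `front_{p+1} ∘ δ_{p+1} = front_p`. [folklore] -/
private theorem nerveFrontMap_comp_succAbove_last (h : p + q = m) :
    nerveFrontMap (p + 1) (m + 1) (by omega) ∘ Fin.succAbove (Fin.last (p + 1)) =
      nerveFrontMap p (m + 1) (by omega) := by
  funext t
  apply Fin.ext
  simp only [Function.comp_apply, nerveFrontMap, val_succAbove, Fin.val_last]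
  split_ifs <;> omega

open Literature.AlgebraicTopology.SingularHomology.TwistedPrism (val_succAbove) in
/-- The first coface of the back: `back_{q+1} ∘ δ₀ = back_q`. [folklore] -/
private theorem nerveBackMap_comp_succAbove_zero (h : p + q = m) :
    nerveBackMap (q + 1) (m + 1) (by omega) ∘ Fin.succAbove (0 : Fin (q + 2)) =
      nerveBackMap q (m + 1) (by omega) := by
  funext t
  apply Fin.ext
  simp only [Function.comp_apply, nerveBackMap, val_succAbove, Fin.val_zero]
  split_ifs <;> omega

/-- Splitting a sum over `Fin (m + 2)` into the cofaces `a ≤ p` and `a = p + 1 + b`. [folklore] -/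
private theorem sum_fin_split {X : Type u} [AddCommMonoid X] (h : p + q = m) (F : Fin (m + 2) → X) :
    ∑ a : Fin (m + 2), F a =
      ∑ i : Fin (p + 1), F ⟨i, by omega⟩ + ∑ j : Fin (q + 1), F ⟨p + 1 + j, by omega⟩ := by
  have hc : p + 1 + (q + 1) = m + 2 := by omega
  rw [← Equiv.sum_comp (finCongr hc), Fin.sum_univ_add]
  rfl

/-- **The Leibniz rule with coefficients**: `δ(f ∪ g) = δf ∪ g + (−1)ᵖ f ∪ δg` in `C^{m+1}(G, M ⊗ N)`
for `f ∈ Cᵖ(G, M)`, `g ∈ C^q(G, N)`, `p + q = m` (Brown V §3, proof of (3.3): "the formula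
`δ(a ∪ b) = δa ∪ b + (−1)^{deg a} a ∪ δb`"). [cite: Brown1982CohomologyGroups, V §3 (3.3) proof] -/
theorem d_cupCochainRep (h : p + q = m) (f : (Fin p → G) → M) (g : (Fin q → G) → N) :
    inhomogeneousCochains.d (M ⊗ N) m (cupCochainRep M N h f g) =
      cupCochainRep M N (show p + 1 + q = m + 1 by omega) (inhomogeneousCochains.d M p f) g +
        (-1 : k) ^ p • cupCochainRep M N (show p + (q + 1) = m + 1 by omega) f
          (inhomogeneousCochains.d N q g) := by
  have h₁ : p + 1 + q = m + 1 := by omega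
  have h₂ : p + (q + 1) = m + 1 := by omega
  funext x
  -- abbreviations for the two extra terms' common value
  -- the left-hand side: cofaces of the tensor of the two pull-backs, split at `p`
  have hL : inhomogeneousCochains.d (M ⊗ N) m (cupCochainRep M N h f g) x =
      ∑ i : Fin (p + 1), (-1 : k) ^ ((⟨i, by omega⟩ : Fin (m + 2)) : ℕ) •
          (nervePull M (Fin.succAbove ⟨i, by omega⟩ ∘ nerveFrontMap p m (by omega)) f x ⊗ₜ[k]
            nervePull N (Fin.succAbove ⟨i, by omega⟩ ∘ nerveBackMap q m (by omega)) g x : M.V ⊗[k] N.V) +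
        ∑ j : Fin (q + 1), (-1 : k) ^ ((⟨p + 1 + j, by omega⟩ : Fin (m + 2)) : ℕ) •
          (nervePull M (Fin.succAbove ⟨p + 1 + j, by omega⟩ ∘ nerveFrontMap p m (by omega)) f x ⊗ₜ[k]
            nervePull N (Fin.succAbove ⟨p + 1 + j, by omega⟩ ∘ nerveBackMap q m (by omega)) g x :
              M.V ⊗[k] N.V) := by
    rw [d_apply_eq_sum_nervePull, cupCochainRep_eq M N h]
    simp only [nervePull_tmul, nervePull_nervePull]
    exact sum_fin_split h _
  -- the first term of the right-hand side
  have hA : cupCochainRep M N h₁ (inhomogeneousCochains.d M p f) g x =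
      ∑ i : Fin (p + 1), (-1 : k) ^ ((⟨i, by omega⟩ : Fin (m + 2)) : ℕ) •
          (nervePull M (Fin.succAbove ⟨i, by omega⟩ ∘ nerveFrontMap p m (by omega)) f x ⊗ₜ[k]
            nervePull N (Fin.succAbove ⟨i, by omega⟩ ∘ nerveBackMap q m (by omega)) g x : M.V ⊗[k] N.V) +
        (-1 : k) ^ (p + 1) • (nervePull M (nerveFrontMap p (m + 1) (by omega)) f x ⊗ₜ[k]
          nervePull N (nerveBackMap q (m + 1) (by omega)) g x : M.V ⊗[k] N.V) := by
    rw [cupCochainRep_apply_eq, nervePull_apply, d_apply_eq_sum_nervePull, map_sum,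
      TensorProduct.sum_tmul, Fin.sum_univ_castSucc]
    congr 1
    · refine Finset.sum_congr rfl fun i _ => ?_
      rw [map_smul, ← nervePull_apply, nervePull_nervePull, succAbove_comp_nerveFrontMap_of_le h _ i rfl,
        succAbove_comp_nerveBackMap_of_le h _ i rfl, TensorProduct.smul_tmul', Fin.val_castSucc]
    · rw [map_smul, ← nervePull_apply, nervePull_nervePull, nerveFrontMap_comp_succAbove_last h,
        TensorProduct.smul_tmul', Fin.val_last]
  -- the second term of the right-hand side
  have hB : (-1 : k) ^ p • cupCochainRep M N h₂ f (inhomogeneousCochains.d N q g) x =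
      (-1 : k) ^ p • (nervePull M (nerveFrontMap p (m + 1) (by omega)) f x ⊗ₜ[k]
          nervePull N (nerveBackMap q (m + 1) (by omega)) g x : M.V ⊗[k] N.V) +
        ∑ j : Fin (q + 1), (-1 : k) ^ ((⟨p + 1 + j, by omega⟩ : Fin (m + 2)) : ℕ) •
          (nervePull M (Fin.succAbove ⟨p + 1 + j, by omega⟩ ∘ nerveFrontMap p m (by omega)) f x ⊗ₜ[k]
            nervePull N (Fin.succAbove ⟨p + 1 + j, by omega⟩ ∘ nerveBackMap q m (by omega)) g x :
              M.V ⊗[k] N.V) := by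
    rw [cupCochainRep_apply_eq, nervePull_apply N (nerveBackMap (q + 1) (m + 1) _),
      d_apply_eq_sum_nervePull, map_sum, TensorProduct.tmul_sum, Fin.sum_univ_succ, smul_add,
      Finset.smul_sum]
    congr 1
    · rw [map_smul, ← nervePull_apply, nervePull_nervePull, nerveBackMap_comp_succAbove_zero h,
        Fin.val_zero, pow_zero, one_smul]
    · refine Finset.sum_congr rfl fun j _ => ?_
      rw [map_smul, ← nervePull_apply, nervePull_nervePull, succAbove_comp_nerveFrontMap_of_gt h _ j rfl,
        succAbove_comp_nerveBackMap_of_gt h _ j rfl, TensorProduct.tmul_smul, smul_smul, ← pow_add,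
        Fin.val_succ]
      congr 1
      exact Literature.AlgebraicTopology.SingularHomology.neg_one_pow_congr k (by simp only; omega)
  -- the two extra terms cancel
  have hcancel : (-1 : k) ^ (p + 1) • (nervePull M (nerveFrontMap p (m + 1) (by omega)) f x ⊗ₜ[k]
        nervePull N (nerveBackMap q (m + 1) (by omega)) g x : M.V ⊗[k] N.V) +
      (-1 : k) ^ p • (nervePull M (nerveFrontMap p (m + 1) (by omega)) f x ⊗ₜ[k]
        nervePull N (nerveBackMap q (m + 1) (by omega)) g x : M.V ⊗[k] N.V) = 0 := by
    rw [← add_smul, pow_succ, mul_neg_one, neg_add_cancel, zero_smul]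
  have key : ∀ S T E₁ E₂ : M.V ⊗[k] N.V, E₁ + E₂ = 0 → S + T = S + E₁ + (E₂ + T) := by
    intro S T E₁ E₂ hE
    rw [add_assoc, ← add_assoc E₁, hE, zero_add]
  rw [Pi.add_apply, Pi.smul_apply, hL, hA, hB]
  exact key _ _ _ _ hcancel

/-- **`f ∪ g` is a cocycle if `f` and `g` are.** [cite: Brown1982CohomologyGroups, V §3] -/
theorem d_cupCochainRep_eq_zero (h : p + q = m) {f : (Fin p → G) → M} {g : (Fin q → G) → N}
    (hf : inhomogeneousCochains.d M p f = 0) (hg : inhomogeneousCochains.d N q g = 0) :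
    inhomogeneousCochains.d (M ⊗ N) m (cupCochainRep M N h f g) = 0 := by
  rw [d_cupCochainRep, hf, hg, (cupCochainRep M N _).map_zero, LinearMap.zero_apply,
    (cupCochainRep M N _ f).map_zero, smul_zero, add_zero]

/-- `δw ∪ g = δ(w ∪ g)` for a cocycle `g`. [cite: Brown1982CohomologyGroups, V §3 (3.3) proof] -/
theorem cupCochainRep_d_left {p' : ℕ} (h' : p' + q = m) (w : (Fin p' → G) → M) {g : (Fin q → G) → N}
    (hg : inhomogeneousCochains.d N q g = 0) :
    cupCochainRep M N (show p' + 1 + q = m + 1 by omega) (inhomogeneousCochains.d M p' w) g =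
      inhomogeneousCochains.d (M ⊗ N) m (cupCochainRep M N h' w g) := by
  rw [d_cupCochainRep, hg, (cupCochainRep M N _ w).map_zero, smul_zero, add_zero]

/-- `f ∪ δw = δ((−1)ᵖ f ∪ w)` for a cocycle `f`. [cite: Brown1982CohomologyGroups, V §3 (3.3') proof] -/
theorem cupCochainRep_d_right {q' : ℕ} (h' : p + q' = m) {f : (Fin p → G) → M}
    (hf : inhomogeneousCochains.d M p f = 0) (w : (Fin q' → G) → N) :
    cupCochainRep M N (show p + (q' + 1) = m + 1 by omega) f (inhomogeneousCochains.d N q' w) =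
      inhomogeneousCochains.d (M ⊗ N) m ((-1 : k) ^ p • cupCochainRep M N h' f w) := by
  rw [map_smul, d_cupCochainRep, hf, (cupCochainRep M N _).map_zero, LinearMap.zero_apply, zero_add,
    smul_smul, ← pow_add, ← two_mul, pow_mul, neg_one_sq, one_pow, one_smul]

end Cochains

/-! ### §3 The cup product on cocycles and on cohomology -/

section Cohomology

variable (M N : Rep.{u} k G) {p q m : ℕ}

/-- The cocycle `z₁ ∪ z₂` (auxiliary). [cite: Brown1982CohomologyGroups, V §3] -/
def cocyclesCupRepAux (h : p + q = m) (z₁ : cocycles M p) (z₂ : cocycles N q) : cocycles (M ⊗ N) m :=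
  cocyclesMk (cupCochainRep M N h (iCocycles M p z₁) (iCocycles N q z₂))
    (d_cupCochainRep_eq_zero M N h (d_iCocycles _ p z₁) (d_iCocycles _ q z₂))

/-- The cochain of `z₁ ∪ z₂` is `i z₁ ∪ i z₂` (auxiliary form). [cite: Brown1982CohomologyGroups, V §3] -/
theorem iCocycles_cocyclesCupRepAux (h : p + q = m) (z₁ : cocycles M p) (z₂ : cocycles N q) :
    iCocycles (M ⊗ N) m (cocyclesCupRepAux M N h z₁ z₂) =
      cupCochainRep M N h (iCocycles M p z₁) (iCocycles N q z₂) :=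
  iCocycles_mk _ (d_cupCochainRep_eq_zero M N h (d_iCocycles _ p z₁) (d_iCocycles _ q z₂))

/-- **The cup product of cocycles `Zᵖ(G, M) × Z^q(G, N) → Zᵐ(G, M ⊗ N)`**, `k`-bilinear.
[cite: Brown1982CohomologyGroups, V §3] -/
def cocyclesCupRep (h : p + q = m) : cocycles M p →ₗ[k] cocycles N q →ₗ[k] cocycles (M ⊗ N) m :=
  LinearMap.mk₂ k (cocyclesCupRepAux M N h)
    (fun z₁ z₁' z₂ => iCocycles_injective _ m (by
      rw [map_add, iCocycles_cocyclesCupRepAux, iCocycles_cocyclesCupRepAux, iCocycles_cocyclesCupRepAux,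
        map_add, map_add, LinearMap.add_apply]))
    (fun c z₁ z₂ => iCocycles_injective _ m (by
      rw [map_smul, iCocycles_cocyclesCupRepAux, iCocycles_cocyclesCupRepAux, map_smul, map_smul,
        LinearMap.smul_apply]))
    (fun z₁ z₂ z₂' => iCocycles_injective _ m (by
      rw [map_add, iCocycles_cocyclesCupRepAux, iCocycles_cocyclesCupRepAux, iCocycles_cocyclesCupRepAux,
        map_add, map_add]))
    (fun c z₁ z₂ => iCocycles_injective _ m (by
      rw [map_smul, iCocycles_cocyclesCupRepAux, iCocycles_cocyclesCupRepAux, map_smul, map_smul]))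

/-- The cochain of `z₁ ∪ z₂` is `i z₁ ∪ i z₂`. [cite: Brown1982CohomologyGroups, V §3] -/
@[simp]
theorem iCocycles_cocyclesCupRep (h : p + q = m) (z₁ : cocycles M p) (z₂ : cocycles N q) :
    iCocycles (M ⊗ N) m (cocyclesCupRep M N h z₁ z₂) =
      cupCochainRep M N h (iCocycles M p z₁) (iCocycles N q z₂) :=
  iCocycles_cocyclesCupRepAux M N h z₁ z₂

/-- The class `[z₁ ∪ z₂]` only depends on the class of `z₁`. [cite: Brown1982CohomologyGroups, V §3] -/
theorem π_cocyclesCupRep_eq_of_π_eq_left (h : p + q = m) {z₁ z₁' : cocycles M p}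
    (hz : π M p z₁ = π M p z₁') (z₂ : cocycles N q) :
    π (M ⊗ N) m (cocyclesCupRep M N h z₁ z₂) = π (M ⊗ N) m (cocyclesCupRep M N h z₁' z₂) := by
  cases p with
  | zero => rw [(π_zero_eq_iff _ z₁ z₁').1 hz]
  | succ p' =>
    obtain ⟨w, hw⟩ := (π_succ_eq_iff M p' z₁ z₁').1 hz
    obtain ⟨m', rfl⟩ : ∃ m', m = m' + 1 := ⟨p' + q, by omega⟩
    have h' : p' + q = m' := by omega
    refine (π_succ_eq_iff (M ⊗ N) m' _ _).2 ⟨cupCochainRep M N h' w (iCocycles N q z₂), ?_⟩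
    rw [iCocycles_cocyclesCupRep, iCocycles_cocyclesCupRep, ← LinearMap.sub_apply, ← map_sub, ← hw]
    exact (cupCochainRep_d_left M N h' w (d_iCocycles _ q z₂)).symm

/-- The class `[z₁ ∪ z₂]` only depends on the class of `z₂`. [cite: Brown1982CohomologyGroups, V §3] -/
theorem π_cocyclesCupRep_eq_of_π_eq_right (h : p + q = m) (z₁ : cocycles M p) {z₂ z₂' : cocycles N q}
    (hz : π N q z₂ = π N q z₂') :
    π (M ⊗ N) m (cocyclesCupRep M N h z₁ z₂) = π (M ⊗ N) m (cocyclesCupRep M N h z₁ z₂') := by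
  cases q with
  | zero => rw [(π_zero_eq_iff _ z₂ z₂').1 hz]
  | succ q' =>
    obtain ⟨w, hw⟩ := (π_succ_eq_iff N q' z₂ z₂').1 hz
    obtain ⟨m', rfl⟩ : ∃ m', m = m' + 1 := ⟨p + q', by omega⟩
    have h' : p + q' = m' := by omega
    refine (π_succ_eq_iff (M ⊗ N) m' _ _).2
      ⟨(-1 : k) ^ p • cupCochainRep M N h' (iCocycles M p z₁) w, ?_⟩
    rw [iCocycles_cocyclesCupRep, iCocycles_cocyclesCupRep, ← map_sub, ← hw]
    exact (cupCochainRep_d_right M N h' (d_iCocycles _ p z₁) w).symm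

/-- The cup product on classes through chosen representing cocycles (auxiliary). [folklore] -/
private def cupProductRepFun (h : p + q = m) (x : groupCohomology M p) (y : groupCohomology N q) :
    groupCohomology (M ⊗ N) m :=
  π (M ⊗ N) m (cocyclesCupRep M N h (Classical.choose (π_surjective M p x))
    (Classical.choose (π_surjective N q y)))

/-- `cupProductRepFun [z₁] [z₂] = [z₁ ∪ z₂]`. [folklore] -/
private theorem cupProductRepFun_π_π (h : p + q = m) (z₁ : cocycles M p) (z₂ : cocycles N q) :
    cupProductRepFun M N h (π _ p z₁) (π _ q z₂) = π (M ⊗ N) m (cocyclesCupRep M N h z₁ z₂) := by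
  unfold cupProductRepFun
  rw [π_cocyclesCupRep_eq_of_π_eq_left M N h (Classical.choose_spec (π_surjective M p (π _ p z₁))),
    π_cocyclesCupRep_eq_of_π_eq_right M N h z₁ (Classical.choose_spec (π_surjective N q (π _ q z₂)))]

/-- **The cup product `∪ : Hᵖ(G, M) × H^q(G, N) → Hᵐ(G, M ⊗ N)`** (`p + q = m`) on Mathlib's group
cohomology, for arbitrary representations `M`, `N` of an arbitrary group `G` over a commutative ring
`k`, `k`-bilinear, induced by Brown's Alexander–Whitney cochain product: `[f] ∪ [g] = [f ∪ g]`
(`cupProductRep_π_π`). [cite: Brown1982CohomologyGroups, V §3] -/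
def cupProductRep (h : p + q = m) :
    groupCohomology M p →ₗ[k] groupCohomology N q →ₗ[k] groupCohomology (M ⊗ N) m :=
  LinearMap.mk₂ k (cupProductRepFun M N h)
    (fun x x' y => by
      induction x using groupCohomology_induction_on with
      | h z =>
        induction x' using groupCohomology_induction_on with
        | h z' =>
          induction y using groupCohomology_induction_on with
          | h w =>
            rw [← map_add, cupProductRepFun_π_π, cupProductRepFun_π_π, cupProductRepFun_π_π, map_add,
              LinearMap.add_apply, map_add])
    (fun c x y => by
      induction x using groupCohomology_induction_on with
      | h z =>
        induction y using groupCohomology_induction_on with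
        | h w =>
          rw [← map_smul, cupProductRepFun_π_π, cupProductRepFun_π_π, map_smul, LinearMap.smul_apply,
            map_smul])
    (fun x y y' => by
      induction x using groupCohomology_induction_on with
      | h z =>
        induction y using groupCohomology_induction_on with
        | h w =>
          induction y' using groupCohomology_induction_on with
          | h w' =>
            rw [← map_add, cupProductRepFun_π_π, cupProductRepFun_π_π, cupProductRepFun_π_π, map_add,
              map_add])
    (fun c x y => by
      induction x using groupCohomology_induction_on with
      | h z =>
        induction y using groupCohomology_induction_on with
        | h w =>
          rw [← map_smul, cupProductRepFun_π_π, cupProductRepFun_π_π, map_smul, map_smul])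

/-- **`[z₁] ∪ [z₂] = [z₁ ∪ z₂]`.** [cite: Brown1982CohomologyGroups, V §3] -/
@[simp]
theorem cupProductRep_π_π (h : p + q = m) (z₁ : cocycles M p) (z₂ : cocycles N q) :
    cupProductRep M N h (π _ p z₁) (π _ q z₂) = π (M ⊗ N) m (cocyclesCupRep M N h z₁ z₂) :=
  cupProductRepFun_π_π M N h z₁ z₂

/-- `[f] ∪ [g] = [f ∪ g]` for cocycles given as cochains with `δ = 0`. [cite: Brown1982CohomologyGroups, V §3] -/
theorem cupProductRep_π_cocyclesMk (h : p + q = m) {f : (Fin p → G) → M} {g : (Fin q → G) → N}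
    (hf : inhomogeneousCochains.d M p f = 0) (hg : inhomogeneousCochains.d N q g = 0) :
    cupProductRep M N h (π _ p (cocyclesMk f hf)) (π _ q (cocyclesMk g hg)) =
      π (M ⊗ N) m (cocyclesMk (cupCochainRep M N h f g) (d_cupCochainRep_eq_zero M N h hf hg)) := by
  rw [cupProductRep_π_π]
  congr 1
  apply iCocycles_injective (M ⊗ N) m
  rw [iCocycles_cocyclesCupRep, iCocycles_mk, iCocycles_mk, iCocycles_mk]

end Cohomology

/-! ### §4 Naturality in the coefficients (Brown (3.2)) -/

section Naturality

variable {M M' N N' : Rep.{u} k G} {p q m : ℕ}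

/-- `(φ ⊗ ψ) ∘ (f ∪ g) = (φ ∘ f) ∪ (ψ ∘ g)` on cochains (`ψ` is `G`-equivariant, so it commutes with the
twist `x₁⋯x_p`). [cite: Brown1982CohomologyGroups, V §3 (3.2)] -/
theorem tensorHom_comp_cupCochainRep (φ : M ⟶ M') (ψ : N ⟶ N') (h : p + q = m) (f : (Fin p → G) → M)
    (g : (Fin q → G) → N) (x : Fin m → G) :
    (φ ⊗ₘ ψ).hom (cupCochainRep M N h f g x) =
      cupCochainRep M' N' h (fun y => φ.hom (f y)) (fun y => ψ.hom (g y)) x := by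
  rw [cupCochainRep_apply, cupCochainRep_apply, Rep.hom_tensorHom,
    Representation.IntertwiningMap.tensor_apply, Rep.hom_comm_apply]

/-- The cochain of a cocycle pushed forward along a coefficient map `φ : M ⟶ M'` is `φ ∘ (i z)`.
[cite: Brown1982CohomologyGroups, V §3 (3.2)] -/
theorem iCocycles_cocyclesMap_id_apply (φ : M ⟶ M') (n : ℕ) (z : cocycles M n) :
    iCocycles M' n (cocyclesMap (MonoidHom.id G) φ n z) = fun y => φ.hom (iCocycles M n z y) := by
  rw [iCocycles_cocyclesMap_id]
  funext y
  exact cochainsMap_id_f_apply φ n _ y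

/-- **Naturality of the cup product in the coefficients** (Brown (3.2)): for `G`-module maps
`φ : M → M'`, `ψ : N → N'` and `u ∈ Hᵖ(G, M)`, `v ∈ H^q(G, N)`,
`(φ ⊗ ψ)_*(u ∪ v) = φ_*u ∪ ψ_*v` in `Hᵐ(G, M' ⊗ N')`, where `φ_* = Hⁿ(G, φ)` is Mathlib's
`groupCohomology.map (MonoidHom.id G) φ n`. [cite: Brown1982CohomologyGroups, V §3 (3.2)] -/
theorem map_tensorHom_cupProductRep (φ : M ⟶ M') (ψ : N ⟶ N') (h : p + q = m)
    (u : groupCohomology M p) (v : groupCohomology N q) :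
    map (A := M ⊗ N) (MonoidHom.id G) (φ ⊗ₘ ψ) m (cupProductRep M N h u v) =
      cupProductRep M' N' h (map (MonoidHom.id G) φ p u) (map (MonoidHom.id G) ψ q v) := by
  induction u using groupCohomology_induction_on with
  | h z₁ =>
    induction v using groupCohomology_induction_on with
    | h z₂ =>
      rw [cupProductRep_π_π, π_map_apply, π_map_apply, π_map_apply, cupProductRep_π_π]
      congr 1
      apply iCocycles_injective (M' ⊗ N') m
      rw [iCocycles_cocyclesMap_id_apply, iCocycles_cocyclesCupRep, iCocycles_cocyclesCupRep,
        iCocycles_cocyclesMap_id_apply, iCocycles_cocyclesMap_id_apply]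
      funext x
      exact tensorHom_comp_cupCochainRep φ ψ h _ _ x

end Naturality

/-! ### §5 Junction with the trivial-coefficient cup product -/

section Trivial

variable {p q m : ℕ}

/-- With trivial coefficients `k`, `k`: `(f ∪ g)(x) = f(x₁, …, x_p) ⊗ g(x_{p+1}, …, x_m)` (no twist).
[cite: Brown1982CohomologyGroups, V §3 (Alexander–Whitney formula)] -/
theorem cupCochainRep_trivial_apply (h : p + q = m) (f : (Fin p → G) → k) (g : (Fin q → G) → k)
    (x : Fin m → G) :
    cupCochainRep (Rep.trivial k G k) (Rep.trivial k G k) h f g x =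
      (f (frontWord h x) ⊗ₜ[k] g (backWord h x) : k ⊗[k] k) := by
  rw [cupCochainRep_apply, Rep.trivial_ρ_apply]

/-- **The multiplication `k ⊗ k → k` carries Brown's product with trivial coefficients to the
sign-free Alexander–Whitney product `cupCochain` of `GroupCohomologyCupProduct`**:
`μ((f ∪ g)(x)) = f(x₁, …, x_p) g(x_{p+1}, …, x_m)` ("`H*(G, k) ⊗ H*(G, k) → H*(G, k ⊗ k) → H*(G, k)`
… induced by the multiplication map `k ⊗ k → k`"). [cite: Brown1982CohomologyGroups, V §3 (after (3.6))] -/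
theorem lid_cupCochainRep_trivial (h : p + q = m) (f : (Fin p → G) → k) (g : (Fin q → G) → k)
    (x : Fin m → G) :
    TensorProduct.lid k k (cupCochainRep (Rep.trivial k G k) (Rep.trivial k G k) h f g x) =
      cupCochain h f g x := by
  rw [cupCochainRep_trivial_apply, TensorProduct.lid_tmul, cupCochain_apply, smul_eq_mul]

/-- **On cohomology: `μ_*([u] ∪ [v]) = [u] ∪ [v]`** — the map `Hᵐ(G, k ⊗ k) → Hᵐ(G, k)` induced by the
multiplication `k ⊗ k → k` (the left unitor `λ` of `Rep k G` at the unit `k`) carries the cup product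
with coefficients to the cup product `cupProduct` of `GroupCohomologyCupProduct`
("`H*(G, k) ⊗ H*(G, k) → H*(G, k ⊗ k) → H*(G, k)`"). [cite: Brown1982CohomologyGroups, V §3 (after (3.6))] -/
theorem map_leftUnitor_cupProductRep_trivial (h : p + q = m)
    (u : groupCohomology (Rep.trivial k G k) p) (v : groupCohomology (Rep.trivial k G k) q) :
    map (A := Rep.trivial k G k ⊗ Rep.trivial k G k) (MonoidHom.id G) (λ_ (Rep.trivial k G k)).hom m
        (cupProductRep (Rep.trivial k G k) (Rep.trivial k G k) h u v) = cupProduct h u v := by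
  induction u using groupCohomology_induction_on with
  | h z₁ =>
    induction v using groupCohomology_induction_on with
    | h z₂ =>
      rw [cupProductRep_π_π, π_map_apply, cupProduct_π_π]
      congr 1
      apply iCocycles_injective (Rep.trivial k G k) m
      rw [iCocycles_cocyclesMap_id_apply, iCocycles_cocyclesCupRep, iCocycles_cocyclesCup]
      funext x
      exact lid_cupCochainRep_trivial h _ _ x

end Trivial

/-! ### §6 The unit (Brown (3.4) with coefficients) -/

section Unit

variable (M N : Rep.{u} k G) {p q : ℕ}

/-- `λ((c ∪ g)(x)) = c · g(x)` for a constant `0`-cochain `c ∈ k = C⁰(G, k)`: the left unitor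
`λ : k ⊗ N ≅ N` identifies `1 ∪ g` with `g`. [cite: Brown1982CohomologyGroups, V §3 (3.4)] -/
theorem leftUnitor_cupCochainRep (c : k) (g : (Fin q → G) → N) (x : Fin q → G) :
    (λ_ N).hom.hom (cupCochainRep (Rep.trivial k G k) N (zero_add q) (fun _ => c) g x) = c • g x := by
  have hx : backWord (zero_add q) x = x :=
    funext fun j => congrArg x (Fin.ext (by simp only [Fin.val_cast, Fin.val_natAdd]; omega))
  have h0 : (⟨0, by omega⟩ : Fin (q + 1)) = 0 := rfl
  rw [cupCochainRep_apply, hx, h0, Fin.partialProd_zero, map_one, Module.End.one_apply]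
  rfl

/-- `ρ((f ∪ c)(x)) = c · f(x)` for a constant `0`-cochain `c`: the right unitor `ρ : M ⊗ k ≅ M`
identifies `f ∪ 1` with `f` (the twist acts trivially on `k`). [cite: Brown1982CohomologyGroups, V §3 (3.4)] -/
theorem rightUnitor_cupCochainRep (f : (Fin p → G) → M) (c : k) (x : Fin p → G) :
    (ρ_ M).hom.hom (cupCochainRep M (Rep.trivial k G k) (add_zero p) f (fun _ => c) x) = c • f x := by
  rw [cupCochainRep_apply, Rep.trivial_ρ_apply]
  rfl

/-- **`1 ∪ v = v`** (Brown (3.4)): `λ_*([1] ∪ v) = v` for `v ∈ H^q(G, N)`, `1 = cupUnit ∈ H⁰(G, k)`.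
[cite: Brown1982CohomologyGroups, V §3 (3.4)] -/
theorem map_leftUnitor_cupUnit_cupProductRep (v : groupCohomology N q) :
    map (A := Rep.trivial k G k ⊗ N) (MonoidHom.id G) (λ_ N).hom q
        (cupProductRep (Rep.trivial k G k) N (zero_add q) cupUnit v) = v := by
  induction v using groupCohomology_induction_on with
  | h z =>
    rw [cupUnit, cupProductRep_π_π, π_map_apply]
    congr 1
    apply iCocycles_injective N q
    rw [iCocycles_cocyclesMap_id_apply, iCocycles_cocyclesCupRep, iCocycles_mk]
    funext x
    rw [leftUnitor_cupCochainRep, one_smul]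

/-- **`u ∪ 1 = u`** (Brown (3.4)): `ρ_*(u ∪ [1]) = u` for `u ∈ Hᵖ(G, M)`.
[cite: Brown1982CohomologyGroups, V §3 (3.4)] -/
theorem map_rightUnitor_cupProductRep_cupUnit (u : groupCohomology M p) :
    map (A := M ⊗ Rep.trivial k G k) (MonoidHom.id G) (ρ_ M).hom p
        (cupProductRep M (Rep.trivial k G k) (add_zero p) u cupUnit) = u := by
  induction u using groupCohomology_induction_on with
  | h z =>
    rw [cupUnit, cupProductRep_π_π, π_map_apply]
    congr 1
    apply iCocycles_injective M p
    rw [iCocycles_cocyclesMap_id_apply, iCocycles_cocyclesCupRep, iCocycles_mk]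
    funext x
    rw [rightUnitor_cupCochainRep, one_smul]

end Unit

/-! ### §7 Associativity (Brown (3.5) with coefficients) -/

section Assoc

variable (M N L : Rep.{u} k G) {p q r pq qr m : ℕ}

/-- The twist of an iterated back word: `(x₁⋯x_p) · ((x_{p+1}⋯x_{p+q}) · v) = (x₁⋯x_{p+q}) · v`.
[cite: Brown1982CohomologyGroups, V §3 (3.5)] -/
theorem ρ_partialProd_ρ_partialProd_backWord (h₂ : p + qr = m) (hq : q ≤ qr) (x : Fin m → G) (v : L) :
    L.ρ (Fin.partialProd x ⟨p, by omega⟩) (L.ρ (Fin.partialProd (backWord h₂ x) ⟨q, by omega⟩) v) =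
      L.ρ (Fin.partialProd x ⟨p + q, by omega⟩) v := by
  rw [← Module.End.mul_apply, ← map_mul, backWord_eq_nerveMap h₂, partialProd_nerveMap]
  have h0 : nerveBackMap qr m (by omega) 0 = ⟨p, by omega⟩ :=
    Fin.ext (by simp only [nerveBackMap, Fin.val_zero]; omega)
  have hq' : nerveBackMap qr m (by omega) ⟨q, by omega⟩ = ⟨p + q, by omega⟩ :=
    Fin.ext (by simp only [nerveBackMap]; omega)
  rw [h0, hq', mul_inv_cancel_left]

/-- The twist of a front word: `∏_{<p} (x₁, …, x_{pq}) = x₁⋯x_p = ∏_{<p} x`. [cite: Brown1982CohomologyGroups, V §3 (3.5)] -/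
theorem partialProd_frontWord (h₁ : pq + r = m) (hp : p ≤ pq) (x : Fin m → G) :
    Fin.partialProd (frontWord h₁ x) ⟨p, by omega⟩ = Fin.partialProd x ⟨p, by omega⟩ := by
  rw [frontWord_eq_nerveMap h₁, partialProd_nerveMap]
  have h0 : nerveFrontMap pq m (by omega) 0 = 0 := rfl
  rw [h0, Fin.partialProd_zero, inv_one, one_mul]
  rfl

/-- **Associativity on the cochain level, with coefficients**: the associator
`α : (M ⊗ N) ⊗ L ≅ M ⊗ (N ⊗ L)` carries `(f ∪ g) ∪ l` to `f ∪ (g ∪ l)` ("associativity holds on the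
cochain level as an identity in `Hom_G(F ⊗ F ⊗ F, M₁ ⊗ M₂ ⊗ M₃)`"), along any bracketing of the
degrees. [cite: Brown1982CohomologyGroups, V §3 (3.5)] -/
theorem associator_cupCochainRep (hpq : p + q = pq) (hqr : q + r = qr) (h₁ : pq + r = m)
    (h₂ : p + qr = m) (f : (Fin p → G) → M) (g : (Fin q → G) → N) (l : (Fin r → G) → L)
    (x : Fin m → G) :
    (α_ M N L).hom.hom (cupCochainRep (M ⊗ N) L h₁ (cupCochainRep M N hpq f g) l x) =
      cupCochainRep M (N ⊗ L) h₂ f (cupCochainRep N L hqr g l) x := by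
  simp only [cupCochainRep_apply]
  have hf : frontWord hpq (frontWord h₁ x) = frontWord h₂ x := funext fun i => rfl
  have hg : backWord hpq (frontWord h₁ x) = frontWord hqr (backWord h₂ x) := funext fun j => rfl
  have hl : backWord h₁ x = backWord hqr (backWord h₂ x) :=
    funext fun j => congrArg x (Fin.ext (by simp only [Fin.val_cast, Fin.val_natAdd]; omega))
  rw [hf, hg, hl, partialProd_frontWord h₁ (by omega)]
  have e : (⟨p + q, by omega⟩ : Fin (m + 1)) = ⟨pq, by omega⟩ := Fin.ext (by simp only; omega)
  have hρ : (N ⊗ L).ρ (Fin.partialProd x ⟨p, by omega⟩)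
        (g (frontWord hqr (backWord h₂ x)) ⊗ₜ[k]
          L.ρ (Fin.partialProd (backWord h₂ x) ⟨q, by omega⟩) (l (backWord hqr (backWord h₂ x)))) =
      (N.ρ (Fin.partialProd x ⟨p, by omega⟩) (g (frontWord hqr (backWord h₂ x))) ⊗ₜ[k]
        L.ρ (Fin.partialProd x ⟨pq, by omega⟩) (l (backWord hqr (backWord h₂ x))) : N.V ⊗[k] L.V) := by
    rw [← e, ← ρ_partialProd_ρ_partialProd_backWord L h₂ (by omega) x]
    rfl
  rw [hρ]
  rfl

/-- **Associativity `(u ∪ v) ∪ w = u ∪ (v ∪ w)` on cohomology, with coefficients** (Brown (3.5)):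
`α_*((u ∪ v) ∪ w) = u ∪ (v ∪ w)` in `Hᵐ(G, M ⊗ (N ⊗ L))`, along any bracketing
`p + q = pq`, `q + r = qr`, `pq + r = m = p + qr`. [cite: Brown1982CohomologyGroups, V §3 (3.5)] -/
theorem map_associator_cupProductRep (hpq : p + q = pq) (hqr : q + r = qr) (h₁ : pq + r = m)
    (h₂ : p + qr = m) (u : groupCohomology M p) (v : groupCohomology N q) (w : groupCohomology L r) :
    map (A := (M ⊗ N) ⊗ L) (MonoidHom.id G) (α_ M N L).hom m
        (cupProductRep (M ⊗ N) L h₁ (cupProductRep M N hpq u v) w) =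
      cupProductRep M (N ⊗ L) h₂ u (cupProductRep N L hqr v w) := by
  induction u using groupCohomology_induction_on with
  | h z₁ =>
    induction v using groupCohomology_induction_on with
    | h z₂ =>
      induction w using groupCohomology_induction_on with
      | h z₃ =>
        rw [cupProductRep_π_π, cupProductRep_π_π, π_map_apply, cupProductRep_π_π, cupProductRep_π_π]
        congr 1
        apply iCocycles_injective (M ⊗ (N ⊗ L)) m
        rw [iCocycles_cocyclesMap_id_apply, iCocycles_cocyclesCupRep, iCocycles_cocyclesCupRep,
          iCocycles_cocyclesCupRep, iCocycles_cocyclesCupRep]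
        funext x
        exact associator_cupCochainRep M N L hpq hqr h₁ h₂ _ _ _ x

end Assoc

end Literature.Algebra.Homology

end
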